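import Summits.QuantumFields.YangMills.Theorems.FluctuationComparisonRegPrIntLS2BetaCurlBudgetJunctionShare
import HarnessLib

/-!
# S2β · (SCT″-c)₁ — «(L2-VOL) THE VOLUME ROAD»: the fine-site ℓ² energy of the relative chart tower at internal level `K − (J+(t+1))` is at most the
# block VOLUME `(L³)^{t+1}` times the station's READ′-sup energy `E′(t) = Σ_{B : PBond (F.P J) 0} ‖𝟙[READ′_t(B)]·g_t‖²` (S′'s `(t,B)` summand without its `L^t`, VERBATIM) —
# UNCONDITIONAL lattice bookkeeping (no window, no (BKG), no gauge condition)

Cell `ym3-torus` (YM ladder rung R3 = continuum `SU(2)` Yang–Mills on the three-torus at fixed lattice data — a RUNG: NOT d = 4, NOT infinite volume, NOT a mass gap,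
NOT Clay).  Width seat «width 12» `ym3-torus-px12` (gen 27); crux `stmt-QuantumFields-20520`, LINE g18-1 S2β, the c₁ column's source-row energy `E_lin` (✓p839415
`Bsrc_split_le`).  `--kind proof --supports stmt-QuantumFields-20520 --as helper`, count-neutral, DEFINITION-FREE (0 `def`, 0 `instance`, 0 `notation`, 0 `sorry`,
default heartbeats).

WHY (HAZARD «L2-GAUGE», px20 g25 ∕ px12 g27, 2026-09-01T01:19–01:23Z).  The displayed purse letter (L2-TOWER) `Σ_{b : PBond (F.P K) j} ‖X j b‖² ≤ C₂·L^{−j}·Σ_ℓ‖ζ ℓ‖² + C₂′·L^{2(K−J)−j}·REL`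
is FALSE for the naked chart tower (a residual single-site gauge bump at a level-`j` centre has `Σ_b‖X i b‖² = Σ_ℓ‖ζ ℓ‖²` at every `i ≤ j` and `REL = 0` on a flat background:
✓`T4Continuum.iter_gaugeAct`, ✓`covLinAvgR0_covGrad_eq`); ℓ²-decay along the averaging tower needs a level-wise gauge condition ((REG)-class).  But `E_lin` needs no decay
letter: by px10 g26's own count (2026-08-31T23:26:45Z (1)) and the architect's (23:30:47Z (a)) the (BKG) class decay `c̄(i+1)² ∝ L^{−4(t+1)}` BEATS the volume factor of the
fine-site → READ-sup conversion, which in `d = 3` is EXACTLY `(L³)^{t+1}` — this file is that conversion, so that `E_lin ≤ (12·d²·Γ²·Cθ²∕L)·S′` becomes an `S′`-share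
(`β_lin ∝ Cθ² = (C_B·α₀)²`, window constants last, RULING «FB-σ»∕(R-d)); the adapter `Elin_le_readSup` is the sequel.

WHAT IS PROVED (sorry-free).
* §1 ★`sum_sq_le_mul_sum_sq_of_fibres` — generic: if `0 ≤ f i ≤ M (φ i)` and every fibre of `φ` has at most `c` elements, `Σ_i f i² ≤ c·Σ_k M k²` (Mathlib ✓`Finset.sum_fiberwise`).
* §2 ★`card_filter_blockOfIter_dir_eq` — in the standing range, `#{b : PBond P i | blockOfIter n b.src = Y ∧ b.dir = μ} = (L^d)^n` (lit ✓`B7SectAStatements.card_blockJ`).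
* §3 ★★`read'_of_blockOfIter_eq` — a level-`K−(J+(t+1))` bond of `F.P K` lying under the coarsest block `(σ⁺B).src`, read back in the member `F.P (J+(t+1))`, satisfies S′'s READ′
  predicate of `B` at thickness `2` (witness its own source, `rel = 0`; transport px13 ✓`siteShift_blockIter_eq_blockOfIter`, lit ✓`siteShift_siteShift`).
* §4 ★★★**`sum_sq_chartTower_le_vol_readSup`** — for `t < K − J`:
  **`Σ_{b : PBond (F.P K) (K−(J+(t+1)))} ‖logVec(su2Quat(Ū^{K−(J+(t+1))}(e^ζU₀) b·(Ū^{K−(J+(t+1))}U₀ b)⁻¹))‖² ≤ (L³)^{t+1}·Σ_{B : PBond (F.P J) 0} ‖𝟙[READ′_t(B)]·g_t‖²`**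
  with the right-hand summand = the `(t,B)` summand of ✓p838904 `c1Budget_of_letters`'s `S′` without its `L^t`, TEXT VERBATIM (`descendTo F ℰp (J+(t+1)) K`, thickness `2`);
  ★★`sum_sq_chartTower_le_vol_readSup_X` — the same in the quaternionic chart tower currency `‖X (K−(J+(t+1))) b‖` of ✓`linBudget_of_chartTower`'s `hXdef` (✓`norm_chartPoint`).
USE.  `E_lin`'s level-`i` term (`i = K−J−1−t`): weights `w(i+1)·L^{K−J−1−(i+1)} ≤ L^{2t}`, class `c̄(i+1)² ≤ Γ²·Cθ²·L^{−4(t+1)}`, volume `L^{3(t+1)}` here ⇒ exponent `t − 1` ⇒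
`E_lin ≤ (12d²Γ²Cθ²∕L)·S′` (t-uniform, no power to spare in `d = 3`; the same ledger in `d = 4` reads `L^{2t}` against `L^t` — divergent: the superrenormalisable margin is one dimension).

HONEST SCOPE.  Lattice∕Pi-sup bookkeeping (one cardinality, one transport) over landed letters; nothing of Bałaban's renormalisation-group analysis is asserted or proved
([Balaban1985Averaging] (2)–(3) p.17, Prop. 4 (128)–(135) pp.37–38; [Balaban1987RG1] (0.1)–(0.4), (0.11) pp.251–253 are the printed conventions); (L2-TOWER) is NOT proved (it is
false as displayed); the class relations, (BKG), (T), (REG), (SUP-DECAY)₀ are others' HYPOTHESES; GAP♯∘ (`stub_uniformFibreGapOrbit`, registry 3732b7df UNTOUCHED, 0∕5), S2β, the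
five registered stubs, crux 20520, 19936, 19200 and `YM3TorusSU2` are NOT proved; no registered stub is closed; rung R3 — NOT d = 4, NOT infinite volume, NOT a mass gap, NOT
Clay; the Yang–Mills mass gap is NOT proved.
-/

set_option autoImplicit false

noncomputable section

open scoped Matrix.Norms.L2Operator
open Finset

namespace Summit.QuantumFields.YangMills.Theorems.FluctuationComparisonRegPrIntLS2BetaChartTowerVolumeReadSup

open Literature.MathematicalPhysics.QuantumFieldTheory.Balaban1983to89
open Literature.MathematicalPhysics.QuantumFieldTheory.Balaban1983to89.T4Continuum
open Literature.MathematicalPhysics.QuantumFieldTheory.Balaban1983to89.T3ContinuumYM3Torus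
open Literature.MathematicalPhysics.QuantumFieldTheory.Balaban1983to89.T3LevelShift
open Literature.MathematicalPhysics.QuantumFieldTheory.Balaban1983to89.T3TiltDescent
open Literature.MathematicalPhysics.QuantumFieldTheory.Balaban1983to89.T3UnitLawDensityEML (ℰp)
open Literature.MathematicalPhysics.QuantumFieldTheory.Balaban1983to89.T4HaarSU2ExpChart (expPoint)
open Literature.MathematicalPhysics.QuantumFieldTheory.Balaban1983to89.T4ExpWindowSmallField (logVec)
open Literature.MathematicalPhysics.QuantumFieldTheory.Balaban1983to89.HaarExponentialChart
open Literature.MathematicalPhysics.QuantumFieldTheory.Balaban1983to89.BlockAveraging (blockAvg)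
open Literature.MathematicalPhysics.QuantumFieldTheory.Balaban1983to89.B14.Eq22Determines (blockIter blockIter_zero blockIter_succ)
open Literature.MathematicalPhysics.QuantumFieldTheory.Balaban1983to89.B7SectAStatements (blockOfIter blockOfIter_zero blockOfIter_succ blockJ mem_blockJ card_blockJ)
open Literature.MathematicalPhysics.QuantumFieldTheory.Balaban1983to89.B10Eq27TorusAxialLog (rel rel_self)
open Literature.MathematicalPhysics.QuantumFieldTheory.Balaban1983to89.B10Eq18SigmaSU2 (su2Coord)
open Literature.MathematicalPhysics.QuantumFieldTheory.Balaban1983to89.B10Eq18SigmaSU2Haar (rev)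
open Literature.MathematicalPhysics.QuantumLattice (su2Quat)
open Summit.QuantumFields.YangMills.Theorems.FluctuationComparisonRegPrIntLS2BetaChartReadDescentOntoExpPoint (su2Coord_rev_mem_lie)
open Summit.QuantumFields.YangMills.Theorems.FluctuationComparisonRegPrIntLS2BetaTorusReadTransport (siteShift_blockIter_eq_blockOfIter)
open Summit.QuantumFields.YangMills.Theorems.FluctuationComparisonRegPrIntLS2BetaCurlBudgetJunctionShare (norm_chartPoint)

/-! ## §1 Generic: a fibrewise sum of squares -/

/-- ★ If `0 ≤ f i ≤ M (φ i)` for every `i` and every fibre of `φ` has at most `c` elements, then `Σ_i f i² ≤ c·Σ_k M k²`. [folklore] -/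
theorem sum_sq_le_mul_sum_sq_of_fibres {ι κ : Type*} [Fintype ι] [Fintype κ] [DecidableEq κ]
    (φ : ι → κ) (f : ι → ℝ) (M : κ → ℝ) (c : ℝ)
    (hf0 : ∀ i, 0 ≤ f i) (hfM : ∀ i, f i ≤ M (φ i))
    (hcard : ∀ k, ((Finset.univ.filter fun i => φ i = k).card : ℝ) ≤ c) :
    ∑ i, f i ^ 2 ≤ c * ∑ k, M k ^ 2 := by
  rw [← Finset.sum_fiberwise Finset.univ φ (fun i => f i ^ 2), Finset.mul_sum]
  refine Finset.sum_le_sum fun k _ => ?_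
  calc ∑ i ∈ Finset.univ.filter (fun i => φ i = k), f i ^ 2
      ≤ ∑ i ∈ Finset.univ.filter (fun i => φ i = k), M k ^ 2 := by
        refine Finset.sum_le_sum fun i hi => ?_
        have hik : φ i = k := (Finset.mem_filter.1 hi).2
        have h := hfM i
        rw [hik] at h
        exact pow_le_pow_left₀ (hf0 i) h 2
    _ = ((Finset.univ.filter fun i => φ i = k).card : ℝ) * M k ^ 2 := by
        rw [Finset.sum_const, nsmul_eq_mul]
    _ ≤ c * M k ^ 2 := mul_le_mul_of_nonneg_right (hcard k) (sq_nonneg _)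

/-! ## §2 The bond fibre of an iterated block has exactly `(L^d)^n` bonds per direction -/

/-- ★ `#{b : PBond P i | blockOfIter n b.src = Y ∧ b.dir = μ} = (L^d)^n` in the standing range `i + n ≤ m + K` (lit ✓`card_blockJ`; a bond is its source and its direction).
[cite: Balaban1985Averaging, (2) p.17] -/
theorem card_filter_blockOfIter_dir_eq {P : Params} {i : ℕ} (n : ℕ) (hn : i + n ≤ P.m + P.K) (Y : Site P (i + n)) (μ : Fin P.d) :
    (Finset.univ.filter fun b : PBond P i => blockOfIter n b.src = Y ∧ b.dir = μ).card = (P.L ^ P.d) ^ n := by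
  rw [← card_blockJ n hn Y]
  refine Finset.card_nbij' (fun b : PBond P i => b.src) (fun x : Site P i => (⟨x, μ⟩ : PBond P i)) (fun b hb => ?_) (fun x hx => ?_)
    (fun b hb => ?_) (fun x _ => rfl)
  · simp only [mem_coe, mem_filter, mem_univ, true_and] at hb
    rw [mem_coe, mem_blockJ]
    exact hb.1
  · rw [mem_coe, mem_blockJ] at hx
    simp only [mem_coe, mem_filter, mem_univ, true_and, and_true]
    exact hx
  · simp only [mem_coe, mem_filter, mem_univ, true_and] at hb
    obtain ⟨src, dir⟩ := b
    obtain ⟨-, hd⟩ := hb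
    simp only at hd
    subst hd
    rfl

variable (F : T3Family)

/-! ## §3 READ′ membership of the bonds under a coarsest block -/

/-- ★★ **UNDER THE BLOCK ⟹ IN READ′**: a bond `b` of `F.P K` at internal level `K − (J+(t+1))` whose `(t+1)`-fold block ancestor is the transported coarsest site `(σ⁺B).src`,
read back in the member `F.P (J+(t+1))` at its finest level, satisfies the station's READ′ predicate of `B` at thickness `2` (witness: its own source, `rel = 0`).
[cite: Balaban1987RG1, (0.1)-(0.4) pp.251-253] -/
theorem read'_of_blockOfIter_eq {J K t : ℕ} (ht : t < K - J) (B : PBond (F.P J) 0) (b : PBond (F.P K) (K - (J + (t + 1))))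
    (hb : blockOfIter (t + 1) b.src =
      (bondShift (F.sitesPerDir_eq (m := F.m) (K := J) (j := 0) (m' := F.m) (K' := K) (j' := K - (J + (t + 1)) + (t + 1)) (by omega)) B).src) :
    ∃ z : Site (F.P (J + (t + 1))) 0,
      (blockIter (t + 1) z = (bondShift (F.sitesPerDir_eq (m := F.m) (K := J) (j := 0) (m' := F.m) (K' := J + (t + 1)) (j' := t + 1) (by omega)) B).src ∨
        blockIter (t + 1) z = (bondShift (F.sitesPerDir_eq (m := F.m) (K := J) (j := 0) (m' := F.m) (K' := J + (t + 1)) (j' := t + 1) (by omega)) B).tgt) ∧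
      ∀ ν, (rel z ((bondShift (F.sitesPerDir_eq (m := F.m) (K := J + (t + 1)) (j := 0) (m' := F.m) (K' := K) (j' := K - (J + (t + 1))) (by omega))).symm b).src ν).natAbs ≤ 2 := by
  have h'' : (F.PP F.m (J + (t + 1))).sitesPerDir 0 = (F.PP F.m K).sitesPerDir (K - (J + (t + 1))) :=
    F.sitesPerDir_eq (m := F.m) (K := J + (t + 1)) (j := 0) (m' := F.m) (K' := K) (j' := K - (J + (t + 1))) (by omega)
  have h₁ : (F.PP F.m J).sitesPerDir 0 = (F.PP F.m (J + (t + 1))).sitesPerDir (t + 1) :=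
    F.sitesPerDir_eq (m := F.m) (K := J) (j := 0) (m' := F.m) (K' := J + (t + 1)) (j' := t + 1) (by omega)
  have h₃ : (F.PP F.m (J + (t + 1))).sitesPerDir (t + 1) = (F.PP F.m K).sitesPerDir (K - (J + (t + 1)) + (t + 1)) :=
    F.sitesPerDir_eq (m := F.m) (K := J + (t + 1)) (j := t + 1) (m' := F.m) (K' := K) (j' := K - (J + (t + 1)) + (t + 1)) (by omega)
  refine ⟨(siteShift h'').symm b.src, ?_, fun ν => ?_⟩
  · left
    apply (siteShift h₃).injective
    have key := siteShift_blockIter_eq_blockOfIter (F := F) (K₁ := J + (t + 1)) (K₂ := K) (n := K - (J + (t + 1))) (by omega) ((siteShift h'').symm b.src) (t + 1)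
    rw [Equiv.apply_symm_apply] at key
    refine key.trans (hb.trans ?_)
    rw [bondShift_src, bondShift_src, siteShift_siteShift]
  · have e : rel ((siteShift h'').symm b.src) ((siteShift h'').symm b.src) ν = 0 := by rw [rel_self]; rfl
    show (rel ((siteShift h'').symm b.src) ((siteShift h'').symm b.src) ν).natAbs ≤ 2
    exact (congrArg Int.natAbs e).trans_le (by decide)

/-! ## §4 The volume road -/

/-- ★★★ **(L2-VOL) THE VOLUME ROAD** — see the module header: the fine-site ℓ² energy of the relative log sizes at internal level `K − (J+(t+1))` is at most `(L³)^{t+1}` times the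
station's READ′-sup energy `E′(t)` (S′'s `(t,B)` summand without `L^t`, text verbatim). [cite: Balaban1985Averaging, (2)-(3) p.17, Prop. 4 (128)-(135) pp.37-38; Balaban1987RG1, (0.1)-(0.4), (0.11) pp.251-253] -/
theorem sum_sq_chartTower_le_vol_readSup {J K t : ℕ} (ht : t < K - J)
    (U₀ : GaugeField (F.P K) 0 (Matrix.specialUnitaryGroup (Fin 2) ℂ)) (ζ : PBond (F.P K) 0 → EuclideanSpace ℝ (Fin 3)) :
    ∑ b : PBond (F.P K) (K - (J + (t + 1))),
        ‖logVec (su2Quat (Averaging.iter (fun k => BlockAveraging.blockAvg (P := F.P K) (j := k) ℰp) (K - (J + (t + 1))) (fun ℓ => expPoint (ζ ℓ) * U₀ ℓ : GaugeField (F.P K) 0 (Matrix.specialUnitaryGroup (Fin 2) ℂ)) b * (Averaging.iter (fun k => BlockAveraging.blockAvg (P := F.P K) (j := k) ℰp) (K - (J + (t + 1))) U₀ b)⁻¹))‖ ^ 2 ≤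
      ((F.L : ℝ) ^ 3) ^ (t + 1) *
        ∑ B : PBond (F.P J) 0,
            ‖(fun ℓ' : PBond (F.P (J + (t + 1))) 0 =>
              if ∃ z : Site (F.P (J + (t + 1))) 0,
                (B14.Eq22Determines.blockIter (t + 1) z = (bondShift (F.sitesPerDir_eq (m := F.m) (K := J) (j := 0) (m' := F.m) (K' := J + (t + 1)) (j' := t + 1) (by omega)) B).src ∨ B14.Eq22Determines.blockIter (t + 1) z = (bondShift (F.sitesPerDir_eq (m := F.m) (K := J) (j := 0) (m' := F.m) (K' := J + (t + 1)) (j' := t + 1) (by omega)) B).tgt) ∧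
                ∀ ν, (B10Eq27TorusAxialLog.rel z ℓ'.src ν).natAbs ≤ 2
              then logVec (su2Quat (descendTo F ℰp (J + (t + 1)) K (by omega) (fun ℓ => expPoint (ζ ℓ) * U₀ ℓ : GaugeField (F.P K) 0 (Matrix.specialUnitaryGroup (Fin 2) ℂ)) ℓ' * (descendTo F ℰp (J + (t + 1)) K (by omega) U₀ ℓ')⁻¹)) else 0)‖ ^ 2 := by
  classical
  -- level identifications
  have hsm : K - (J + (t + 1)) + (t + 1) ≤ (F.P K).m + (F.P K).K := by show K - (J + (t + 1)) + (t + 1) ≤ F.m + K; omega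
  have hplus : (F.PP F.m J).sitesPerDir 0 = (F.PP F.m K).sitesPerDir (K - (J + (t + 1)) + (t + 1)) :=
    F.sitesPerDir_eq (m := F.m) (K := J) (j := 0) (m' := F.m) (K' := K) (j' := K - (J + (t + 1)) + (t + 1)) (by omega)
  have h'' : (F.PP F.m (J + (t + 1))).sitesPerDir 0 = (F.PP F.m K).sitesPerDir (K - (J + (t + 1))) :=
    F.sitesPerDir_eq (m := F.m) (K := J + (t + 1)) (j := 0) (m' := F.m) (K' := K) (j' := K - (J + (t + 1))) (by omega)
  -- the fibre map: each fine bond is assigned to the coarsest bond above it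
  refine (sum_sq_le_mul_sum_sq_of_fibres
    (fun b : PBond (F.P K) (K - (J + (t + 1))) => (bondShift hplus).symm ⟨blockOfIter (t + 1) b.src, b.dir⟩)
    (fun b => ‖logVec (su2Quat (Averaging.iter (fun k => BlockAveraging.blockAvg (P := F.P K) (j := k) ℰp) (K - (J + (t + 1))) (fun ℓ => expPoint (ζ ℓ) * U₀ ℓ : GaugeField (F.P K) 0 (Matrix.specialUnitaryGroup (Fin 2) ℂ)) b * (Averaging.iter (fun k => BlockAveraging.blockAvg (P := F.P K) (j := k) ℰp) (K - (J + (t + 1))) U₀ b)⁻¹))‖)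
    (fun B : PBond (F.P J) 0 => ‖(fun ℓ' : PBond (F.P (J + (t + 1))) 0 =>
              if ∃ z : Site (F.P (J + (t + 1))) 0,
                (B14.Eq22Determines.blockIter (t + 1) z = (bondShift (F.sitesPerDir_eq (m := F.m) (K := J) (j := 0) (m' := F.m) (K' := J + (t + 1)) (j' := t + 1) (by omega)) B).src ∨ B14.Eq22Determines.blockIter (t + 1) z = (bondShift (F.sitesPerDir_eq (m := F.m) (K := J) (j := 0) (m' := F.m) (K' := J + (t + 1)) (j' := t + 1) (by omega)) B).tgt) ∧
                ∀ ν, (B10Eq27TorusAxialLog.rel z ℓ'.src ν).natAbs ≤ 2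
              then logVec (su2Quat (descendTo F ℰp (J + (t + 1)) K (by omega) (fun ℓ => expPoint (ζ ℓ) * U₀ ℓ : GaugeField (F.P K) 0 (Matrix.specialUnitaryGroup (Fin 2) ℂ)) ℓ' * (descendTo F ℰp (J + (t + 1)) K (by omega) U₀ ℓ')⁻¹)) else 0)‖)
    (((F.L : ℝ) ^ 3) ^ (t + 1)) (fun b => norm_nonneg _) (fun b => ?_) (fun B => ?_))
  · -- (value) the bond's relative log size is one of the values read by READ′ of its coarsest bond
    have hB : blockOfIter (t + 1) b.src = (bondShift hplus ((bondShift hplus).symm ⟨blockOfIter (t + 1) b.src, b.dir⟩)).src := by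
      rw [Equiv.apply_symm_apply]; rfl
    have hread := read'_of_blockOfIter_eq F ht ((bondShift hplus).symm ⟨blockOfIter (t + 1) b.src, b.dir⟩) b hB
    have hval := norm_le_pi_norm (fun ℓ' : PBond (F.P (J + (t + 1))) 0 =>
              if ∃ z : Site (F.P (J + (t + 1))) 0,
                (B14.Eq22Determines.blockIter (t + 1) z = (bondShift (F.sitesPerDir_eq (m := F.m) (K := J) (j := 0) (m' := F.m) (K' := J + (t + 1)) (j' := t + 1) (by omega)) ((bondShift hplus).symm ⟨blockOfIter (t + 1) b.src, b.dir⟩)).src ∨ B14.Eq22Determines.blockIter (t + 1) z = (bondShift (F.sitesPerDir_eq (m := F.m) (K := J) (j := 0) (m' := F.m) (K' := J + (t + 1)) (j' := t + 1) (by omega)) ((bondShift hplus).symm ⟨blockOfIter (t + 1) b.src, b.dir⟩)).tgt) ∧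
                ∀ ν, (B10Eq27TorusAxialLog.rel z ℓ'.src ν).natAbs ≤ 2
              then logVec (su2Quat (descendTo F ℰp (J + (t + 1)) K (by omega) (fun ℓ => expPoint (ζ ℓ) * U₀ ℓ : GaugeField (F.P K) 0 (Matrix.specialUnitaryGroup (Fin 2) ℂ)) ℓ' * (descendTo F ℰp (J + (t + 1)) K (by omega) U₀ ℓ')⁻¹)) else 0)
      ((bondShift h'').symm b)
    rw [if_pos hread] at hval
    have hb : ∀ U : GaugeField (F.P K) 0 (Matrix.specialUnitaryGroup (Fin 2) ℂ),
        descendTo F ℰp (J + (t + 1)) K (by omega) U ((bondShift h'').symm b) = Averaging.iter (fun k => BlockAveraging.blockAvg (P := F.P K) (j := k) ℰp) (K - (J + (t + 1))) U b := by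
      intro U
      show Averaging.iter (fun k => BlockAveraging.blockAvg (P := F.P K) (j := k) ℰp) (K - (J + (t + 1))) U (bondShift h'' ((bondShift h'').symm b)) = _
      rw [Equiv.apply_symm_apply]
    rw [hb, hb] at hval
    exact hval
  · -- (count) the fibre is a block of order `t+1` in one direction
    have hfib : (Finset.univ.filter fun b : PBond (F.P K) (K - (J + (t + 1))) => (bondShift hplus).symm ⟨blockOfIter (t + 1) b.src, b.dir⟩ = B) =
        Finset.univ.filter fun b : PBond (F.P K) (K - (J + (t + 1))) => blockOfIter (t + 1) b.src = (bondShift hplus B).src ∧ b.dir = (bondShift hplus B).dir := by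
      ext b
      simp only [Finset.mem_filter, Finset.mem_univ, true_and, Equiv.symm_apply_eq]
      constructor
      · intro h; rw [← h]; exact ⟨rfl, rfl⟩
      · rintro ⟨h1, h2⟩
        rcases hc : bondShift hplus B with ⟨src', dir'⟩
        rw [hc] at h1 h2
        simp only at h1 h2
        subst h1 h2
        rfl
    rw [hfib]
    have hc := card_filter_blockOfIter_dir_eq (P := F.P K) (i := K - (J + (t + 1))) (t + 1) hsm (bondShift hplus B).src (bondShift hplus B).dir
    have hLd : ((F.P K).L ^ (F.P K).d) ^ (t + 1) = (F.L ^ 3) ^ (t + 1) := rfl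
    have h1 : (Finset.univ.filter fun b : PBond (F.P K) (K - (J + (t + 1))) =>
        blockOfIter (t + 1) b.src = (bondShift hplus B).src ∧ b.dir = (bondShift hplus B).dir).card = (F.L ^ 3) ^ (t + 1) := by
      rw [← hLd]; convert hc
    rw [h1]
    push_cast
    exact le_rfl

/-- ★★ **(L2-VOL) IN CHART CURRENCY**: the same bound for the quaternionic chart tower `X` of ✓`linBudget_of_chartTower` (`hXdef`; `‖X i b‖ = ‖logVec …‖` by ✓`norm_chartPoint`).
[cite: Balaban1985Averaging, (2)-(3) p.17, Prop. 4 (128)-(135) pp.37-38; Balaban1987RG1, (0.11) p.253] -/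
theorem sum_sq_chartTower_le_vol_readSup_X {J K t : ℕ} (ht : t < K - J)
    (U₀ : GaugeField (F.P K) 0 (Matrix.specialUnitaryGroup (Fin 2) ℂ)) (ζ : PBond (F.P K) 0 → EuclideanSpace ℝ (Fin 3))
    (X : (i : ℕ) → PBond (F.P K) i → (specialUnitaryLogChart (Fin 2)).lie)
    (hXdef : X = fun (i : ℕ) (b : PBond (F.P K) i) =>
      (⟨su2Coord (rev (logVec (su2Quat (Averaging.iter (fun k => BlockAveraging.blockAvg (P := F.P K) (j := k) ℰp) i (fun ℓ => expPoint (ζ ℓ) * U₀ ℓ : GaugeField (F.P K) 0 (Matrix.specialUnitaryGroup (Fin 2) ℂ)) b * (Averaging.iter (fun k => BlockAveraging.blockAvg (P := F.P K) (j := k) ℰp) i U₀ b)⁻¹)))), su2Coord_rev_mem_lie _⟩ : (specialUnitaryLogChart (Fin 2)).lie)) :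
    ∑ b : PBond (F.P K) (K - (J + (t + 1))), ‖X (K - (J + (t + 1))) b‖ ^ 2 ≤
      ((F.L : ℝ) ^ 3) ^ (t + 1) *
        ∑ B : PBond (F.P J) 0,
            ‖(fun ℓ' : PBond (F.P (J + (t + 1))) 0 =>
              if ∃ z : Site (F.P (J + (t + 1))) 0,
                (B14.Eq22Determines.blockIter (t + 1) z = (bondShift (F.sitesPerDir_eq (m := F.m) (K := J) (j := 0) (m' := F.m) (K' := J + (t + 1)) (j' := t + 1) (by omega)) B).src ∨ B14.Eq22Determines.blockIter (t + 1) z = (bondShift (F.sitesPerDir_eq (m := F.m) (K := J) (j := 0) (m' := F.m) (K' := J + (t + 1)) (j' := t + 1) (by omega)) B).tgt) ∧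
                ∀ ν, (B10Eq27TorusAxialLog.rel z ℓ'.src ν).natAbs ≤ 2
              then logVec (su2Quat (descendTo F ℰp (J + (t + 1)) K (by omega) (fun ℓ => expPoint (ζ ℓ) * U₀ ℓ : GaugeField (F.P K) 0 (Matrix.specialUnitaryGroup (Fin 2) ℂ)) ℓ' * (descendTo F ℰp (J + (t + 1)) K (by omega) U₀ ℓ')⁻¹)) else 0)‖ ^ 2 := by
  subst hXdef
  simp only [norm_chartPoint]
  exact sum_sq_chartTower_le_vol_readSup F ht U₀ ζ

end Summit.QuantumFields.YangMills.Theorems.FluctuationComparisonRegPrIntLS2BetaChartTowerVolumeReadSup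

end
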